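import Summits.KontsevichZagierPeriods.Zeta5Search.WedgeDictionarySlotSevenTwo
import HarnessLib

/-!
# CF-M3 in the interior: the induction along slot 7, modulo the recurrence of `Ω` (cell `pub-zeta5`)

HONEST FRAMING: systematic search; no irrationality claim unless certified.

OUR work (Summit side; lead/literature seat generation 4, 2026-08-20). Step L9 of the cell's Lean plan for the
interior of CF-M3 (`casoratianClosedForm`; PROOF-NOTES-g5 §4, §10.2), complete MODULO step L8: the four-term
recurrence REC3′ of `Ω` along slot 7, which is taken here as an explicit HYPOTHESIS (`OmegaRec3` below, stated in
the tree's vocabulary; gen-1 g5 has it kernel-checked at an integer running parameter in an abstract form,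
`OmegaRec.rec3'_int`, and is writing the bridge `omegaVWP_rec3`). Given that hypothesis,
`casoratianClosedForm_of_omegaRec3` is the statement of `casoratianClosedForm` for every admissible `b` — the
conjecture in full, unfolded — by strong induction on `b₇`:
the layers `b₇ ≤ 2` are `casoratianClosedForm_of_slot_le_two` (faces, I1, I2), and for `b₇ ≥ 3` the Casoratian
recurrence `quadM3_rec3` (REC3) at `a = b − 3e₇`, the three induction hypotheses at `a, a+e₇, a+2e₇`, three slot-7
bookkeeping steps and REC3′ at `a` combine by pure bookkeeping algebra (no further identity is needed: in the gauge
`Y = S·d!·∏(N−b_k)!·Ω/(N!·∏(N−b_j−b_k)!)` REC3 for `Y` IS REC3′ for `Ω`, PROOF-NOTES-g5 §4.4).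

So, once the hypothesis is a theorem `omegaVWP_rec3` of the tree, `casoratianClosedForm` is a theorem
(`fun b hb hd hle hp => casoratianClosedForm_of_omegaRec3 omegaVWP_rec3 b hb hd hle hp`).
-/

noncomputable section

open Finset Polynomial

namespace Summit.KontsevichZagierPeriods.Zeta5Search.WedgeDictionary

open Summit.KontsevichZagierPeriods.Zeta5Search.DualSeries
open Literature.NumberTheory.Transcendental

/-- **CF-M3 for every admissible shape, modulo the recurrence REC3′ of `Ω` along slot 7.**
The hypothesis: for every `a` in the box with `d(a) ≥ 3`, all `a_j ≤ N`, all pair sums of `a + 3e₇` at most `N`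
(stated as the pair sums of `a` plus `a_i + a₇ + 3 ≤ N`), with `B = a₇ + 2`, `γ₁ = topGamma1 (a+e₇)`,
`γ₂ = topGamma2 a`, `E(N−B) = ∏_{i≤6}(N − a_i − B)`:
`−E(N−B)·Ω(a+3e₇) − (N−B)γ₁·Ω(a+2e₇) − (N−B)B(N+1−B)γ₂·Ω(a+e₇) + (N−B)B(B−1)(N+1−B)(N+2−B)·d(a)·Ω(a) = 0`
(`3N+2−B−|c| = d(a)`). -/
theorem casoratianClosedForm_of_omegaRec3
    (hΩ : ∀ a : ℕ → ℤ, InBox a → 3 ≤ dOf a → (∀ j ∈ Icc 1 7, a j ≤ a 0) →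
      (∀ jk ∈ allPairs, a jk.1 + a jk.2 ≤ a 0) → (∀ i ∈ range 6, a (i + 1) + a 7 + 3 ≤ a 0) →
      -(∏ i ∈ range 6, ((a 0 : ℚ) - a (i + 1) - ((a 7 : ℚ) + 2))) * omegaVWP (bump (bump (bump a 6) 6) 6) -
          ((a 0 : ℚ) - ((a 7 : ℚ) + 2)) * topGamma1 (bump a 6) * omegaVWP (bump (bump a 6) 6) -
          ((a 0 : ℚ) - ((a 7 : ℚ) + 2)) * ((a 7 : ℚ) + 2) * ((a 0 : ℚ) + 1 - ((a 7 : ℚ) + 2)) * topGamma2 a *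
            omegaVWP (bump a 6) +
          ((a 0 : ℚ) - ((a 7 : ℚ) + 2)) * ((a 7 : ℚ) + 2) * ((a 7 : ℚ) + 1) * ((a 0 : ℚ) + 1 - ((a 7 : ℚ) + 2)) *
            ((a 0 : ℚ) + 2 - ((a 7 : ℚ) + 2)) * (dOf a : ℚ) * omegaVWP a = 0)
    (b : ℕ → ℤ) (hb : InBox b) (hd : 0 ≤ dOf b) (hle : ∀ j ∈ Icc 1 7, b j ≤ b 0)
    (hpairs : ∀ jk ∈ allPairs, b jk.1 + b jk.2 ≤ b 0) :
    quadM3 b * (((b 0).toNat.factorial : ℚ) *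
        (allPairs.map fun jk => ((b 0 - b jk.1 - b jk.2).toNat.factorial : ℚ)).prod) =
      (-1 : ℚ) ^ (b 0).toNat * 4 * ((dOf b).toNat.factorial : ℚ) *
        (∏ j ∈ range 7, ((b 0 - b (j + 1)).toNat.factorial : ℚ)) * omegaVWP b := by
  suffices H : ∀ n : ℕ, ∀ b : ℕ → ℤ, InBox b → 0 ≤ dOf b → (∀ j ∈ Icc 1 7, b j ≤ b 0) →
      (∀ jk ∈ allPairs, b jk.1 + b jk.2 ≤ b 0) → (b 7).toNat = n →
      quadM3 b * (((b 0).toNat.factorial : ℚ) *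
          (allPairs.map fun jk => ((b 0 - b jk.1 - b jk.2).toNat.factorial : ℚ)).prod) =
        (-1 : ℚ) ^ (b 0).toNat * 4 * ((dOf b).toNat.factorial : ℚ) *
          (∏ j ∈ range 7, ((b 0 - b (j + 1)).toNat.factorial : ℚ)) * omegaVWP b from
    H _ b hb hd hle hpairs rfl
  clear hb hd hle hpairs b
  intro n
  induction n using Nat.strong_induction_on with
  | _ n ih =>
  intro b hb hd hle hpairs hn
  have h77 : (7 : ℕ) ∈ Icc 1 7 := mem_Icc.2 ⟨by norm_num, le_rfl⟩
  by_cases h72 : b 7 ≤ 2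
  · exact casoratianClosedForm_of_slot_le_two b hb hd hle hpairs h77 h72
  -- `b₇ ≥ 3`: the base shape `a = b − 3e₇` and the intermediate shapes `a + e₇`, `a + 2e₇`
  have hi7 : (6 : ℕ) ∈ range 7 := mem_range.2 (by norm_num)
  have hb7N : b 7 ≤ b 0 := hle 7 h77
  have hc : ∀ i ∈ range 6, b (i + 1) + b 7 ≤ b 0 := fun i hi =>
    pair_le_of_allPairs hpairs (j := i + 1) (k := 7) (by omega) (by have := mem_range.1 hi; omega)
      (by norm_num) le_rfl (by have := mem_range.1 hi; omega)
  have hc0 : ∀ i ∈ range 6, 0 ≤ b (i + 1) := fun i hi =>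
    (hb.2 i (by have := mem_range.1 hi; exact mem_range.2 (by omega))).1
  set a : ℕ → ℤ := Function.update b 7 (b 7 - 3) with ha
  have ha7 : a 7 = b 7 - 3 := Function.update_self _ _ _
  have ha_ne : ∀ k, k ≠ 7 → a k = b k := fun k hk => Function.update_of_ne hk _ _
  have ha0 : a 0 = b 0 := ha_ne 0 (by norm_num)
  have e10 : bump a 6 0 = b 0 := (bump_zero a 6).trans ha0
  have e20 : bump (bump a 6) 6 0 = b 0 := (bump_zero _ 6).trans e10
  have e17 : bump a 6 7 = b 7 - 2 := by rw [bump6_seven, ha7]; ring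
  have e27 : bump (bump a 6) 6 7 = b 7 - 1 := by rw [bump6_seven, e17]; ring
  have e1i : ∀ i ∈ range 6, bump a 6 (i + 1) = b (i + 1) := fun i hi => by
    rw [bump_of_ne a (by have := mem_range.1 hi; omega), ha_ne (i + 1) (by have := mem_range.1 hi; omega)]
  have e2i : ∀ i ∈ range 6, bump (bump a 6) 6 (i + 1) = b (i + 1) := fun i hi => by
    rw [bump_of_ne _ (by have := mem_range.1 hi; omega), e1i i hi]
  have hbbb : bump (bump (bump a 6) 6) 6 = b := by
    funext k
    by_cases hk : k = 7
    · rw [hk, bump6_seven, e27]; ring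
    · rw [bump_of_ne _ (show k ≠ 6 + 1 by omega), bump_of_ne _ (show k ≠ 6 + 1 by omega),
        bump_of_ne _ (show k ≠ 6 + 1 by omega), ha_ne k hk]
  have hmono : ∀ x : ℕ → ℤ, (x = a ∨ x = bump a 6 ∨ x = bump (bump a 6) 6) → ∀ k, x k ≤ b k := by
    rintro x (rfl | rfl | rfl) k
    · by_cases hk : k = 7
      · rw [hk, ha7]; omega
      · rw [ha_ne k hk]
    · by_cases hk : k = 7
      · rw [hk, e17]; omega
      · rw [bump_of_ne a (show k ≠ 6 + 1 by omega), ha_ne k hk]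
    · by_cases hk : k = 7
      · rw [hk, e27]; omega
      · rw [bump_of_ne _ (show k ≠ 6 + 1 by omega), bump_of_ne a (show k ≠ 6 + 1 by omega), ha_ne k hk]
  -- admissibility of the three lower shapes
  have admiss : ∀ x : ℕ → ℤ, (x = a ∨ x = bump a 6 ∨ x = bump (bump a 6) 6) → x 0 = b 0 → 0 ≤ x 7 →
      InBox x ∧ (∀ j ∈ Icc 1 7, x j ≤ x 0) ∧ (∀ jk ∈ allPairs, x jk.1 + x jk.2 ≤ x 0) := by
    intro x hx hx0 hx7
    have hxk := hmono x hx
    have hxi : ∀ i ∈ range 6, x (i + 1) = b (i + 1) := by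
      rcases hx with rfl | rfl | rfl
      · exact fun i hi => ha_ne (i + 1) (by have := mem_range.1 hi; omega)
      · exact e1i
      · exact e2i
    refine ⟨⟨by rw [hx0]; exact hb.1, fun j hj => ?_⟩, fun j hj => ?_, fun jk hjk => ?_⟩
    · by_cases hj6 : j = 6
      · rw [hj6, show (6 : ℕ) + 1 = 7 from rfl, hx0]; have := hxk 7; constructor <;> omega
      · rw [hxi j (by have := mem_range.1 hj; exact mem_range.2 (by omega)), hx0]
        exact hb.2 j hj
    · rw [hx0]; exact (hxk j).trans (hle j hj)
    · rw [hx0]; have := hpairs jk hjk; have := hxk jk.1; have := hxk jk.2; omega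
  obtain ⟨hA, hleA, hpA⟩ := admiss a (Or.inl rfl) ha0 (by rw [ha7]; omega)
  obtain ⟨hA1, hleA1, hpA1⟩ := admiss (bump a 6) (Or.inr (Or.inl rfl)) e10 (by rw [e17]; omega)
  obtain ⟨hA2, hleA2, hpA2⟩ := admiss (bump (bump a 6) 6) (Or.inr (Or.inr rfl)) e20 (by rw [e27]; omega)
  have hd1 : dOf (bump a 6) = dOf a - 1 := dOf_bump a hi7
  have hd2 : dOf (bump (bump a 6) 6) = dOf a - 2 := by rw [dOf_bump _ hi7, hd1]; ring
  have hda : dOf a = dOf b + 3 := by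
    have := dOf_bump (bump (bump a 6) 6) hi7; rw [hbbb, hd2] at this; omega
  -- the induction hypotheses
  have IH0 := ih ((a 7).toNat) (by rw [ha7]; omega) a hA (by omega) hleA hpA rfl
  have IH1 := ih ((bump a 6 7).toNat) (by rw [e17]; omega) (bump a 6) hA1 (by rw [hd1]; omega) hleA1 hpA1 rfl
  have IH2 := ih ((bump (bump a 6) 6 7).toNat) (by rw [e27]; omega) (bump (bump a 6) 6) hA2
    (by rw [hd2]; omega) hleA2 hpA2 rfl
  -- REC3 for `M₃` and REC3′ for `Ω` at `a`
  have REC := quadM3_rec3 a hA (by omega) (by rw [ha7, ha0]; omega)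
  have OREC := hΩ a hA (by omega) hleA hpA (fun i hi => by
    rw [ha_ne (i + 1) (by have := mem_range.1 hi; omega), ha7, ha0]; have := hc i hi; omega)
  rw [hbbb] at REC OREC
  -- the `γ`'s
  have hG3 : topGamma3 a = -((dOf b : ℚ) + 2) := by rw [topGamma3_eq, hda]; push_cast; ring
  have hG3p : topGamma3 (bump a 6) = -((dOf b : ℚ) + 1) := by rw [topGamma3_eq, hd1, hda]; push_cast; ring
  have hG0 : topGamma0 a = ((b 7 : ℚ) - 2) * ∏ i ∈ range 6, ((b 0 : ℚ) - b (i + 1) - ((b 7 : ℚ) - 3)) := by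
    rw [topGamma0_eq, ha7, ha0]; push_cast
    rw [show (b 7 : ℚ) - 3 + 1 = (b 7 : ℚ) - 2 by ring]
    congr 1
    exact prod_congr rfl fun i hi => by rw [ha_ne (i + 1) (by have := mem_range.1 hi; omega)]; ring
  have hG0p : topGamma0 (bump a 6) =
      ((b 7 : ℚ) - 1) * ∏ i ∈ range 6, ((b 0 : ℚ) - b (i + 1) - ((b 7 : ℚ) - 2)) := by
    rw [topGamma0_eq, e17, e10]; push_cast
    rw [show (b 7 : ℚ) - 2 + 1 = (b 7 : ℚ) - 1 by ring]
    congr 1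
    exact prod_congr rfl fun i hi => by rw [e1i i hi]; ring
  -- slot-7 bookkeeping, three steps
  have hP0 := pairProd_slot7_step a (fun i hi => by
    rw [ha_ne (i + 1) (by have := mem_range.1 hi; omega), ha7, ha0]; have := hc i hi; omega)
  have hP1 := pairProd_slot7_step (bump a 6) (fun i hi => by
    rw [e1i i hi, e17, e10]; have := hc i hi; omega)
  have hP2 := pairProd_slot7_step (bump (bump a 6) 6) (fun i hi => by
    rw [e2i i hi, e27, e20]; have := hc i hi; omega)
  have hF0 := singles_slot7_step a (by rw [ha7, ha0]; omega)
  have hF1 := singles_slot7_step (bump a 6) (by rw [e17, e10]; omega)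
  have hF2 := singles_slot7_step (bump (bump a 6) 6) (by rw [e27, e20]; omega)
  have hD0 := dfact_slot7_step a (by omega)
  have hD1 := dfact_slot7_step (bump a 6) (by rw [hd1]; omega)
  have hD2 := dfact_slot7_step (bump (bump a 6) 6) (by rw [hd2]; omega)
  -- canonical products
  have hE0 : ∏ i ∈ range 6, ((a 0 : ℚ) - a (i + 1) - a 7) =
      ∏ i ∈ range 6, ((b 0 : ℚ) - b (i + 1) - ((b 7 : ℚ) - 3)) :=
    prod_congr rfl fun i hi => by
      rw [ha0, ha_ne (i + 1) (by have := mem_range.1 hi; omega), ha7]; push_cast; ring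
  have hE1 : ∏ i ∈ range 6, ((bump a 6 0 : ℚ) - bump a 6 (i + 1) - bump a 6 7) =
      ∏ i ∈ range 6, ((b 0 : ℚ) - b (i + 1) - ((b 7 : ℚ) - 2)) :=
    prod_congr rfl fun i hi => by rw [e10, e1i i hi, e17]; push_cast; ring
  have hE2 : ∏ i ∈ range 6, ((bump (bump a 6) 6 0 : ℚ) - bump (bump a 6) 6 (i + 1) - bump (bump a 6) 6 7) =
      ∏ i ∈ range 6, ((b 0 : ℚ) - b (i + 1) - ((b 7 : ℚ) - 1)) :=
    prod_congr rfl fun i hi => by rw [e20, e2i i hi, e27]; push_cast; ring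
  have hE2' : ∏ i ∈ range 6, ((a 0 : ℚ) - a (i + 1) - ((a 7 : ℚ) + 2)) =
      ∏ i ∈ range 6, ((b 0 : ℚ) - b (i + 1) - ((b 7 : ℚ) - 1)) :=
    prod_congr rfl fun i hi => by
      rw [ha0, ha_ne (i + 1) (by have := mem_range.1 hi; omega), ha7]; push_cast; ring
  rw [hE0] at hP0
  rw [hE1] at hP1
  rw [hE2, hbbb] at hP2
  rw [hbbb] at hF2 hD2
  rw [hE2', ha7, ha0, hda] at OREC
  push_cast at OREC
  simp only [ha0] at hP0 hF0 IH0
  simp only [ha7] at hF0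
  simp only [e10] at hP1 hF1 IH1
  simp only [e17] at hF1
  simp only [e20] at hP2 hF2 IH2
  simp only [e27] at hF2
  simp only [hd1, hd2, hda] at hD0 hD1 hD2 IH0 IH1 IH2
  push_cast at hF0 hF1 hF2 hD0 hD1 hD2
  -- the nonzero multiplier `(d+1)(d+2)·E₀E₁E₂`
  have hEpos : ∀ t : ℚ, 0 < t → 0 < ∏ i ∈ range 6, ((b 0 : ℚ) - b (i + 1) - ((b 7 : ℚ) - t)) := by
    intro t ht
    refine prod_pos fun i hi => ?_
    have h1 := hc i hi
    have : ((b (i + 1) : ℤ) : ℚ) + (b 7 : ℤ) ≤ ((b 0 : ℤ) : ℚ) := by exact_mod_cast h1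
    linarith
  have hdb : (0 : ℚ) ≤ (dOf b : ℚ) := by exact_mod_cast hd
  have hK : ((dOf b : ℚ) + 2) * ((dOf b : ℚ) + 1) *
      ((∏ i ∈ range 6, ((b 0 : ℚ) - b (i + 1) - ((b 7 : ℚ) - 3))) *
        (∏ i ∈ range 6, ((b 0 : ℚ) - b (i + 1) - ((b 7 : ℚ) - 2))) *
        ∏ i ∈ range 6, ((b 0 : ℚ) - b (i + 1) - ((b 7 : ℚ) - 1))) ≠ 0 :=
    mul_ne_zero (mul_ne_zero (by intro h; linarith) (by intro h; linarith))
      (mul_ne_zero (mul_ne_zero (hEpos 3 (by norm_num)).ne' (hEpos 2 (by norm_num)).ne')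
        (hEpos 1 (by norm_num)).ne')
  refine mul_left_cancel₀ hK ?_
  -- atoms
  set N : ℚ := (b 0 : ℚ) with hN
  set β : ℚ := (b 7 : ℚ) with hβ
  set db : ℚ := (dOf b : ℚ) with hdb'
  set E0 := ∏ i ∈ range 6, (N - b (i + 1) - (β - 3)) with hE0'
  set E1 := ∏ i ∈ range 6, (N - b (i + 1) - (β - 2)) with hE1'
  set E2 := ∏ i ∈ range 6, (N - b (i + 1) - (β - 1)) with hE2''
  set S := (-1 : ℚ) ^ (b 0).toNat * 4 with hS
  set NF := ((b 0).toNat.factorial : ℚ) with hNF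
  set Pb := (allPairs.map fun jk => ((b 0 - b jk.1 - b jk.2).toNat.factorial : ℚ)).prod with hPb
  set Pa2 := (allPairs.map fun jk =>
    ((b 0 - bump (bump a 6) 6 jk.1 - bump (bump a 6) 6 jk.2).toNat.factorial : ℚ)).prod with hPa2
  set Pa1 := (allPairs.map fun jk => ((b 0 - bump a 6 jk.1 - bump a 6 jk.2).toNat.factorial : ℚ)).prod with hPa1
  set Pa := (allPairs.map fun jk => ((b 0 - a jk.1 - a jk.2).toNat.factorial : ℚ)).prod with hPa
  set Fb := ∏ j ∈ range 7, ((b 0 - b (j + 1)).toNat.factorial : ℚ) with hFb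
  set Fa2 := ∏ j ∈ range 7, ((b 0 - bump (bump a 6) 6 (j + 1)).toNat.factorial : ℚ) with hFa2
  set Fa1 := ∏ j ∈ range 7, ((b 0 - bump a 6 (j + 1)).toNat.factorial : ℚ) with hFa1
  set Fa := ∏ j ∈ range 7, ((b 0 - a (j + 1)).toNat.factorial : ℚ) with hFa
  set Db := (((dOf b).toNat.factorial : ℕ) : ℚ) with hDb
  set Da2 := (((dOf b + 3 - 2).toNat.factorial : ℕ) : ℚ) with hDa2
  set Da1 := (((dOf b + 3 - 1).toNat.factorial : ℕ) : ℚ) with hDa1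
  set Da := (((dOf b + 3).toNat.factorial : ℕ) : ℚ) with hDa
  set Mb := quadM3 b with hMb
  set M2 := quadM3 (bump (bump a 6) 6) with hM2
  set M1 := quadM3 (bump a 6) with hM1
  set Ma := quadM3 a with hMa
  set Ωb := omegaVWP b with hΩb
  set Ω2 := omegaVWP (bump (bump a 6) 6) with hΩ2
  set Ω1 := omegaVWP (bump a 6) with hΩ1
  set Ωa := omegaVWP a with hΩa
  set G3 := topGamma3 a with hG3'
  set G3p := topGamma3 (bump a 6) with hG3p'
  set G0 := topGamma0 a with hG0'
  set G0p := topGamma0 (bump a 6) with hG0p'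
  set G1p := topGamma1 (bump a 6) with hG1p
  set G2 := topGamma2 a with hG2
  linear_combination (E0 * E1 * E2 * NF * Pb) * REC +
    (-(G3p * E0 * E1 * E2 * NF * Pb * Mb) + S * Db * Fb * (db + 1) * (N - β + 1) * G1p * E0 * E1 * Ω2) * hG3 +
    ((db + 2) * E0 * E1 * E2 * NF * Pb * Mb) * hG3p +
    (-(G1p * G3 * E0 * E1 * M2 * NF) + G0p * G2 * E0 * E1 * M1 * NF - G0p * G0 * E0 * E1 * Ma * NF) * hP2 +
    (G0p * G2 * E0 * M1 * NF - G0p * G0 * E0 * Ma * NF) * hP1 +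
    (-(G0p * G0 * Ma * NF)) * hP0 +
    (G1p * G3 * E0 * E1) * IH2 + (-(G0p * G2 * E0)) * IH1 + (G0p * G0) * IH0 +
    (S * G1p * G3 * E0 * E1 * Fa2 * Ω2 - S * G0p * G2 * E0 * (db + 2) * Fa1 * Ω1 +
      S * G0p * G0 * (db + 3) * (db + 2) * Fa * Ωa) * hD2 +
    (S * G1p * G3 * E0 * E1 * Db * (db + 1) * Ω2 - S * G0p * G2 * E0 * (db + 2) * Db * (db + 1) * (N - β + 2) * Ω1 +
      S * G0p * G0 * (db + 3) * (db + 2) * (db + 1) * Db * (N - β + 3) * (N - β + 2) * Ωa) * hF2 +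
    (-(S * G0p * G2 * E0 * Fa1 * Ω1) + S * G0p * G0 * (db + 3) * Fa * Ωa) * hD1 +
    (-(S * G0p * G2 * E0 * (db + 2) * Db * (db + 1) * Ω1) +
      S * G0p * G0 * (db + 3) * (db + 2) * (db + 1) * Db * (N - β + 3) * Ωa) * hF1 +
    (S * G0p * G0 * Fa * Ωa) * hD0 + (S * G0p * G0 * (db + 3) * (db + 2) * Db * (db + 1) * Ωa) * hF0 +
    (S * Db * Fb * (db + 1) * E0 * E1 * (db + 2)) * OREC +
    (S * Db * Fb * (db + 1) * (N - β + 1) * (db + 3) * (db + 2) * (N - β + 3) * (N - β + 2) * Ωa * (β - 1) * E1) *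
      hG0 +
    (S * Db * Fb * (db + 1) * (N - β + 1) *
      (-(G2 * E0 * (db + 2) * (N - β + 2) * Ω1) + (db + 3) * (db + 2) * (N - β + 3) * (N - β + 2) * Ωa * G0)) * hG0p

end Summit.KontsevichZagierPeriods.Zeta5Search.WedgeDictionary
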